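import Summits.ValiantsHypothesis.ValiantsHypothesis.Theorems.DivisionGapPerDivisionHardStubAltFlow

/-!
# Crux `DivisionGap.PerDivisionHard` (stmt-ValiantsHypothesis-5065), line `pair-descent-jss-endpoint`
(skeleton v14) — stub `stub_splitFlow`: splits detect circulations

The block arsenal `G(b,k) ⊕ M₀` (`BlockV`, `blockAdj`, `placedBlock` of
`Theorems/DivisionGapDefs.lean`) is `K_{b,b}` with every core edge `(i, j)` subdivided into the
path  row `i` — col `(i,j,0)` — row `(i,j,0)` — col `(i,j,1)` — … — row `(i,j,k-1)` — col `j`,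
padded by a perfect matching; circulations (integer functions on (row label, column label) pairs
supported on edges with vanishing row and column sums) and their path structure come from
`Theorems/DivisionGapPerDivisionHardStubSparseRigidFlow.lean` (`flow_path`, `pathVal`, …), the
alternating special case is `Theorems/DivisionGapPerDivisionHardStubAltFlow.lean`.

Suppose a set of cells SPLITS the two cells of an internal column `(i, j, t+1)`: exactly one of
the cells in the rows `(i, j, t)`, `(i, j, t+1)` of that column is selected.
`splitFlow_colSum_ne_zero`: if the path `(i, j)` has nonzero path value `a`, then the
selected-cell-sum of the column `(i, j, t+1)` is `± a ≠ 0` — that column meets exactly the rows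
`(i, j, t)` (value `a`) and `(i, j, t+1)` (value `-a`) (`flow_path`, `adj_internalCol`), exactly
one of which is selected.  A circulation vanishes on padding columns
(`altFlow_paddingCol_eq_zero`).  Transported to a placement `eR eC : BlockV b k m ≃ Fin n` this is
the registered stub `stub_splitFlow`: for a nonzero integer matrix `D` supported on the placed
graph with vanishing row and column sums and a cell set `Y` splitting every placed internal
column `eC (i, j, t+1)`, `t + 1 < k`, the `Y`-column-contents `c ↦ Σ_{r : (r, c) ∈ Y} D (r, c)`
are nonzero on at least `k - 1` columns (the columns `eC (i, j, 1), …, eC (i, j, k-1)` of a path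
with nonzero path value, `exists_pathVal_ne_zero`), and every column with nonzero `Y`-content is
not a padding column.
-/

noncomputable section

-- `Summit.ValiantsHypothesis.ValiantsHypothesis.…` is the tree's mandated single-conjunct layout
-- (Sub = Summit), so the duplicated namespace component is intended.
set_option linter.dupNamespace false

namespace Summit.ValiantsHypothesis.ValiantsHypothesis.Theorems.DivisionGapPerDivisionHard

open MvPolynomial Literature.Computability.AlgebraicComplexity
open Summit.ValiantsHypothesis.ValiantsHypothesis.Theorems.ZeroOneTransfer.Negative
open scoped NNReal

variable {b k m : ℕ}

section Flow

variable {F : BlockV b k m → BlockV b k m → ℤ}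
variable (hF : (∀ r ℓ, F r ℓ ≠ 0 → blockAdj b k m r ℓ = true) ∧
    (∀ r, ∑ ℓ, F r ℓ = 0) ∧ ∀ ℓ, ∑ r, F r ℓ = 0)
include hF

/-- **A split detects a path.**  If the path `(i, j)` has nonzero path value `a` and the cell
predicate `p` of the internal column `(i, j, t+1)` selects exactly one of the two rows
`(i, j, t)`, `(i, j, t+1)`, then the `p`-sum of that column is nonzero: the column meets exactly
the rows `(i, j, t)` (value `a`) and `(i, j, t+1)` (value `-a`), so the `p`-sum is `a` or `-a`.
[folklore] -/
theorem splitFlow_colSum_ne_zero (hk : 0 < k) {i j : Fin b} (hij : pathVal F hk i j ≠ 0)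
    (t : ℕ) (ht : t + 1 < k) (p : BlockV b k m → Prop) [DecidablePred p]
    (hsplit : p (iv i j ⟨t, Nat.lt_of_succ_lt ht⟩) ↔ ¬p (iv i j ⟨t + 1, ht⟩)) :
    (∑ x, if p x then F x (iv i j ⟨t + 1, ht⟩) else 0) ≠ 0 := by
  have ht0 : t < k := Nat.lt_of_succ_lt ht
  -- the values at the two rows adjacent to the column `(i, j, t+1)`
  have h1 : F (iv i j ⟨t + 1, ht⟩) (iv i j ⟨t + 1, ht⟩) = -pathVal F hk i j :=
    (flow_path hF hk i j (t + 1) ht).1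
  have h0 : F (iv i j ⟨t, ht0⟩) (iv i j ⟨t + 1, ht⟩) = pathVal F hk i j := by
    have := (flow_path hF hk i j t ht0).2
    rwa [nextCol_of_lt i j t ht] at this
  have hne : (iv i j ⟨t + 1, ht⟩ : BlockV b k m) ≠ iv i j ⟨t, ht0⟩ := fun h => by
    have := Fin.mk.inj (Prod.mk.inj (Prod.mk.inj (Sum.inl.inj (Sum.inr.inj h))).2).2
    omega
  -- the nonzero terms of the column sum sit at these two rows
  have hsupp : ∀ x, (if p x then F x (iv i j ⟨t + 1, ht⟩) else 0) ≠ 0 →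
      x = iv i j ⟨t + 1, ht⟩ ∨ x = iv i j ⟨t, ht0⟩ := by
    intro x hx
    have hx' : F x (iv i j ⟨t + 1, ht⟩) ≠ 0 := fun h => hx (by simp [h])
    rcases adj_internalCol (hF.1 _ _ hx') with h | h
    · exact Or.inl h
    · exact Or.inr (h.trans (prevRow_succ i j t ht))
  rw [sum_eq_of_ne_zero_imp_or _ _ _ hne hsupp]
  -- exactly one of the two rows is selected
  by_cases hp0 : p (iv i j ⟨t, ht0⟩)
  · have hn1 : ¬p (iv i j ⟨t + 1, ht⟩) := hsplit.mp hp0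
    rw [if_neg hn1, if_pos hp0, h0, zero_add]
    exact hij
  · have hy1 : p (iv i j ⟨t + 1, ht⟩) := by
      by_contra h
      exact hp0 (hsplit.mpr h)
    rw [if_pos hy1, if_neg hp0, h1, add_zero, neg_ne_zero]
    exact hij

end Flow

/-- **`stub_splitFlow` (registered sub-goal of the line, skeleton v14): splits detect
circulations.**  Let `D` be an integer matrix supported on a placed block graph
`placedBlock eR eC` (`k ≥ 1`) with vanishing row and column sums, and let the cell set `Y`
split the two cells of every placed internal column `eC (i, j, t+1)`, `t + 1 < k` (exactly one
of the cells in the rows `eR (i, j, t)`, `eR (i, j, t+1)` lies in `Y`).  If `D ≠ 0` then (i) at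
least `k - 1` columns `c` have a nonzero `Y`-column-content `Σ_{r : (r, c) ∈ Y} D (r, c)` (the
columns `eC (i, j, 1), …, eC (i, j, k-1)` of a path `(i, j)` with nonzero path value, by
`splitFlow_colSum_ne_zero`), and (ii) a column with nonzero `Y`-column-content is not a padding
column (`altFlow_paddingCol_eq_zero`). [folklore] -/
theorem stub_splitFlow :
    ∀ (b k m n : ℕ) (eR eC : BlockV b k m ≃ Fin n) (Y : Finset (Fin n × Fin n)) (D : Fin n × Fin n → ℤ), 0 < k →
      (∀ e, D e ≠ 0 → e ∈ placedBlock eR eC) → (∀ r, ∑ c, D (r, c) = 0) → (∀ c, ∑ r, D (r, c) = 0) →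
      (∀ (i j : Fin b) (t : ℕ) (ht : t + 1 < k),
          ((eR (Sum.inr (Sum.inl (i, j, ⟨t, Nat.lt_of_succ_lt ht⟩))), eC (Sum.inr (Sum.inl (i, j, ⟨t + 1, ht⟩)))) ∈ Y ↔
            (eR (Sum.inr (Sum.inl (i, j, ⟨t + 1, ht⟩))), eC (Sum.inr (Sum.inl (i, j, ⟨t + 1, ht⟩)))) ∉ Y)) →
      (∃ e, D e ≠ 0) →
      k - 1 ≤ (Finset.univ.filter fun c : Fin n =>
          ∑ r ∈ Finset.univ.filter (fun r : Fin n => (r, c) ∈ Y), D (r, c) ≠ 0).card ∧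
        ∀ (c : Fin n) (u : Fin m), ∑ r ∈ Finset.univ.filter (fun r : Fin n => (r, c) ∈ Y), D (r, c) ≠ 0 →
          eC.symm c ≠ Sum.inr (Sum.inr u) := by
  intro b k m n eR eC Y D hk hG hrow hcol hsplit hne
  have hF := labelFlow_of_placed eR eC hG hrow hcol
  refine ⟨?_, fun c u hsum hu => hsum (Finset.sum_eq_zero fun r _ => ?_)⟩
  · -- (i) `k - 1` columns with nonzero `Y`-column-content
    obtain ⟨⟨r₀, c₀⟩, h₀⟩ := hne
    have hne' : ∃ r ℓ, (fun r ℓ => D (eR r, eC ℓ)) r ℓ ≠ 0 :=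
      ⟨eR.symm r₀, eC.symm c₀, by simpa using h₀⟩
    obtain ⟨r, ℓ, h⟩ := hne'
    obtain ⟨i, j, hij⟩ := exists_pathVal_ne_zero hF hk h
    -- the `Y`-column-content of a placed column, in label coordinates
    have hcolSum : ∀ ℓ : BlockV b k m,
        ∑ r ∈ Finset.univ.filter (fun r : Fin n => (r, eC ℓ) ∈ Y), D (r, eC ℓ) =
          ∑ x, if (eR x, eC ℓ) ∈ Y then D (eR x, eC ℓ) else 0 := by
      intro ℓ
      rw [Finset.sum_filter]
      exact (Equiv.sum_comp eR (fun r => if (r, eC ℓ) ∈ Y then D (r, eC ℓ) else 0)).symm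
    have hmem : ∀ (t : ℕ) (ht : t + 1 < k), eC (iv i j ⟨t + 1, ht⟩) ∈
        Finset.univ.filter fun c : Fin n =>
          ∑ r ∈ Finset.univ.filter (fun r : Fin n => (r, c) ∈ Y), D (r, c) ≠ 0 := by
      intro t ht
      rw [Finset.mem_filter, hcolSum]
      exact ⟨Finset.mem_univ _, splitFlow_colSum_ne_zero hF hk hij t ht
        (fun x => (eR x, eC (iv i j ⟨t + 1, ht⟩)) ∈ Y) (hsplit i j t ht)⟩
    -- the `k - 1` later internal columns of the path `(i, j)` are distinct
    let φ : Fin (k - 1) → Fin n := fun s => eC (iv i j ⟨(s : ℕ) + 1, by omega⟩)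
    have hinj : Function.Injective φ := by
      intro s₁ s₂ hs
      have := Fin.mk.inj
        (Prod.mk.inj (Prod.mk.inj (Sum.inl.inj (Sum.inr.inj (eC.injective hs)))).2).2
      exact Fin.ext (by omega)
    calc k - 1 = (Finset.univ : Finset (Fin (k - 1))).card := (Finset.card_fin _).symm
      _ ≤ (Finset.univ.filter fun c : Fin n =>
            ∑ r ∈ Finset.univ.filter (fun r : Fin n => (r, c) ∈ Y), D (r, c) ≠ 0).card :=
        Finset.card_le_card_of_injOn φ (fun s _ => hmem s (by omega)) hinj.injOn
  · -- (ii) a padding column carries only zeros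
    have h0 := altFlow_paddingCol_eq_zero hF (eR.symm r) u
    rw [← hu] at h0
    simpa using h0

end Summit.ValiantsHypothesis.ValiantsHypothesis.Theorems.DivisionGapPerDivisionHard

end
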